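import Literature.NumberTheory.Transcendental.AnalytificationCharts
import Literature.NumberTheory.Transcendental.AnalytificationImplicit
import Literature.NumberTheory.Transcendental.AnalytificationFunctorialityProofs
import Literature.AlgebraicGeometry.Motives.AlgPointsProperProofs
import HarnessLib

/-!
# Holomorphic algebraic charts of a smooth scheme (proof file)

This file discharges the named fact `Literature.NumberTheory.Transcendental.exists_algebraicChart` of
`Literature.NumberTheory.Transcendental.AnalytificationCharts` (`Literature.NumberTheory.Transcendental.exists_algebraicChart_holds`):
every complex point of a `k`-scheme `X` (`k ⊆ ℂ`), locally of finite type and smooth of relative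
dimension `d`, lies in the source of a chart of `X(ℂ)` (strong topology) onto an open subset of
`ℂᵈ` whose coordinates are regular functions and in which all regular functions are holomorphic
[Serre, GAGA §2 n°5 Lemme 1, Prop. 2 and n°6 Prop. 3, Cor. 2; SGA1 XII Thm. 1.1,
Prop. 3.1 (iv)]. Together with the Hausdorffness of `X(ℂ)` for `X` separated
(`Literature.NumberTheory.Transcendental.t2Space_algPoints_holds`, `AnalytificationSeparatedProofs`) and the assembly
`Literature.NumberTheory.Transcendental.exists_isAnalytification_of_exists_algebraicChart` (`AnalytificationCharts`) it yields the
existence of the analytification, `Literature.NumberTheory.Transcendental.exists_isAnalytification` (sibling file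
`AnalytificationExistenceProofs`).

It only adds theorems: the scalars `k → Γ(X, U)` (`SchemeOver.scalarRingHom`) and the points
`AlgPoints.ofRingHom` of affine opens are those of `AlgPointsProperProofs`, whose description
`AlgPoints.nhds_eq_of_mem_affineOpen` of the strong topology on an affine open is used in the
subspace form `AlgPoints.isInducing_pi_eval`; points of an affine open are separated by the
regular functions by `AlgPoints.ext_of_forall_eval_eq` (`AnalytificationFunctorialityProofs`);
the holomorphic implicit function theorem is `Literature.NumberTheory.Transcendental.exists_implicitChart`
(`AnalytificationImplicit`).

## Proof (Serre, GAGA §2 n°5–6)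

Serre defines `X^h` by transporting the analytic structure of the Zariski-locally closed subsets
`U ⊆ ℂⁿ` along the algebraic charts (Lemme 1: such `U` are analytic, regular maps are
holomorphic; Prop. 2), shows that its topology is the coarsest making the regular functions on
Zariski opens continuous (Remarque 1), and that at a simple point `X^h` is a manifold (§1 n°4,
n°6 Cor. 2). In scheme language, for `P₀ ∈ X(ℂ)`:

1. (`AlgPoints.exists_isStandardSmoothOfRelativeDimension_scalarRingHom`) `P₀` has an affine
   open neighbourhood `V` with `Γ(X, V) = k[x₁, …, xₙ]/(F₁, …, F_r)` a *submersive* presentation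
   (Mathlib `SmoothOfRelativeDimension`): `n - r = d` and the Jacobian minor
   `det (∂F_j/∂x_{map i})` is a unit of `Γ(X, V)`.
2. (§ Generators) The coordinates `x = (x₁, …, xₙ) : V(ℂ) → ℂⁿ` are a homeomorphism of `V(ℂ)`
   (strong topology) onto the zero set `Z = {F^ℂ = 0}` (`AlgPoints.isInducing_evalOrZero_val`,
   from `AlgPoints.isInducing_pi_eval`: every regular function is a polynomial in the `xᵢ`;
   `AlgPoints.eq_of_evalOrZero_val_eq`; `AlgPoints.exists_evalOrZero_val_eq`: points of `Z` are
   `k`-algebra maps `Γ(X, V) → ℂ`, i.e. points of `V(ℂ)`), and the Jacobian minor of `F^ℂ` does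
   not vanish on `x(V(ℂ))` (`AlgPoints.det_ne_zero_of_submersivePresentation`). This is
   Serre's Lemme 1 / §1 n°4 setting.
3. (`Literature.NumberTheory.Transcendental.exists_implicitChart`) Near `x(P₀)` the zero set `Z` is the graph of a holomorphic map
   over an open subset `T` of the space `ℂᵈ` of the `d` free coordinates; so
   `P ↦ (x_{E t}(P))_{t : Fin d}` is a chart `e` of `X(ℂ)` at `P₀` with target `T`, whose
   coordinates are regular functions on `V`.
4. A regular function `s` on an affine open `U'` is, near any point of `V ∩ U'`, a fraction
   `g / fᵐ` with `f, g ∈ Γ(X, V)` (`AlgPoints.exists_fraction`), i.e.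
   `s ∘ e⁻¹ = G(ψ(w))/F(ψ(w))ᵐ` with `F, G` complex polynomials and `ψ` the holomorphic inverse
   of the chart: `s` is holomorphic in the chart (Serre's Lemme 1 c)).

## References

* J.-P. Serre, *Géométrie algébrique et géométrie analytique*, Ann. Inst. Fourier **6** (1956),
  §1 n°4; §2 n°5 (Lemme 1, Prop. 2, Remarque 1), n°6 (Prop. 3, Cor. 2).
* A. Grothendieck, M. Raynaud, *SGA 1*, Exposé XII, Thm. 1.1, Prop. 3.1 (iv).
* D. Mumford, *The Red Book of Varieties and Schemes*, I §10, II §4.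
* B. Conrad, *Weil and Grothendieck approaches to adelic points*, Enseign. Math. **58** (2012),
  Prop. 2.1.
* S. Bosch, *Algebraic Geometry and Commutative Algebra*, Springer 2013, §8.5.
* R. Hartshorne, *Algebraic Geometry*, II §2, III §10.
-/

noncomputable section

set_option backward.isDefEq.respectTransparency false

universe u

open CategoryTheory AlgebraicGeometry Topology TensorProduct Limits MvPolynomial Set
open scoped ContDiff Matrix

namespace Literature.NumberTheory.Transcendental

section AlgPoints
open Literature.AlgebraicGeometry.Motives (AlgPoints)
open Literature.AlgebraicGeometry.Motives.AlgPoints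

/-! ### A standard smooth affine neighbourhood -/

section Smooth

variable {k : Type u} [Field k] {X : Literature.AlgebraicGeometry.Motives.SchemeOver k} {L : Type u} [Field L] [Algebra k L]

/-- **Smooth points have standard smooth affine neighbourhoods over `k`.** If `X → Spec k` is
smooth of relative dimension `d` (Mathlib `SmoothOfRelativeDimension`), every point of `X` has an
affine open neighbourhood `V` whose coordinate ring `Γ(X, V)`, as a `k`-algebra via the
scalars `SchemeOver.scalarRingHom X V : k → Γ(X, V)` (of `AlgPointsProperProofs`), is standard
smooth of relative dimension `d` (admits a submersive presentation of dimension `d`). (Mathlib's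
definition asks this for `Γ(Spec k, U') → Γ(X, V)` with `U'` an affine open of `Spec k`; but
`U' = Spec k` and `Γ(Spec k, ⊤) = k`.)
[Hartshorne III §10; Bosch, *Algebraic Geometry and Commutative Algebra* §8.5 Def. 1] [folklore] -/
theorem _root_.Literature.AlgebraicGeometry.Motives.AlgPoints.exists_isStandardSmoothOfRelativeDimension_scalarRingHom (d : ℕ)
    [SmoothOfRelativeDimension d X.hom] (P₀ : AlgPoints X L) :
    ∃ (V : X.left.Opens) (_ : IsAffineOpen V), P₀.pt ∈ V ∧
      RingHom.IsStandardSmoothOfRelativeDimension d (Literature.AlgebraicGeometry.Motives.SchemeOver.scalarRingHom X V) := by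
  obtain ⟨U', -, V, hV, hPV, e, hsm⟩ :=
    SmoothOfRelativeDimension.exists_isStandardSmoothOfRelativeDimension (n := d) (f := X.hom)
      P₀.pt
  have hU'top : U' = ⊤ := by
    ext x
    simp only [TopologicalSpace.Opens.coe_top, Set.mem_univ, iff_true, SetLike.mem_coe]
    obtain rfl : x = X.hom.base P₀.pt := Subsingleton.elim _ _
    exact e hPV
  subst hU'top
  refine ⟨V, hV, hPV, ?_⟩
  exact (RingHom.isStandardSmoothOfRelativeDimension_respectsIso.cancel_left_isIso
    (Scheme.ΓSpecIso (.of k)).inv (X.hom.appLE ⊤ V e)).mpr hsm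

end Smooth

/-! ### Generators of the coordinate ring as coordinates on `L`-points -/

section Generators

variable {k : Type u} [Field k] {X : Literature.AlgebraicGeometry.Motives.SchemeOver k} {L : Type u} [Field L] [Algebra k L]
variable {U : X.left.Opens} {ι : Type*}

/-- The coordinates `Q ↦ (xᵢ(Q))ᵢ : X(L) → L^ι` attached to a family `x : ι → Γ(X, U)` of regular
functions are continuous on `U(L)`. [Serre, GAGA §2 n°5, Remarque] [folklore] -/
theorem _root_.Literature.AlgebraicGeometry.Motives.AlgPoints.continuousOn_evalOrZero_pi [TopologicalSpace L] (x : ι → Γ(X.left, U)) :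
    ContinuousOn (fun (Q : AlgPoints X L) i ↦ evalOrZero U (x i) Q) {Q | Q.pt ∈ U} :=
  continuousOn_pi.mpr fun i ↦ continuousOn_evalOrZero U (x i)

variable [Algebra k Γ(X.left, U)]
  (halg : ∀ c, algebraMap k Γ(X.left, U) c = Literature.AlgebraicGeometry.Motives.SchemeOver.scalarRingHom X U c)
include halg

/-- **Values of polynomial expressions.** If `Γ(X, U)` is a `k`-algebra via the constants, the
value at `Q ∈ U(L)` of `p(x₁, …, xₙ) ∈ Γ(X, U)` (`p` a polynomial over `k`, `xᵢ ∈ Γ(X, U)`) is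
`p^L(x(Q))`: the polynomial `p` with coefficients mapped to `L`, evaluated at the coordinates
`(xᵢ(Q))ᵢ` of `Q`. (`AlgPoints.eval_aeval` of `AnalytificationFunctorialityProofs` is the variant
for the `Γ(Spec k, 𝒪)`-algebra structure given by `X.hom.appLE`; here `Γ(X, U)` is a `k`-algebra
through `SchemeOver.scalarRingHom X U`, as needed for `Algebra.SubmersivePresentation k Γ(X, U)`
and `AlgPoints.ofRingHom`.)
[Serre, GAGA §2 n°5; Mumford, *Red Book* I §10] [folklore] -/
theorem _root_.Literature.AlgebraicGeometry.Motives.AlgPoints.eval_aeval_eq_eval_map (x : ι → Γ(X.left, U)) {Q : AlgPoints X L} (h : Q.pt ∈ U)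
    (p : MvPolynomial ι k) :
    Q.eval U h (MvPolynomial.aeval x p) =
      MvPolynomial.eval (fun i ↦ evalOrZero U (x i) Q) (MvPolynomial.map (algebraMap k L) p) := by
  have H : (Q.evalRingHom U h).comp (MvPolynomial.aeval x).toRingHom =
      MvPolynomial.eval₂Hom (algebraMap k L) (fun i ↦ evalOrZero U (x i) Q) := by
    refine MvPolynomial.ringHom_ext (fun c ↦ ?_) (fun i ↦ ?_)
    · simp only [RingHom.coe_comp, Function.comp_apply, AlgHom.toRingHom_eq_coe,
        RingHom.coe_coe, MvPolynomial.algHom_C, evalRingHom_apply, MvPolynomial.eval₂Hom_C]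
      rw [halg, eval_scalarRingHom]
    · simp only [RingHom.coe_comp, Function.comp_apply, AlgHom.toRingHom_eq_coe,
        RingHom.coe_coe, MvPolynomial.aeval_X, evalRingHom_apply, MvPolynomial.eval₂Hom_X',
        evalOrZero_of_mem _ h]
  have := RingHom.congr_fun H p
  simp only [RingHom.coe_comp, Function.comp_apply, AlgHom.toRingHom_eq_coe, RingHom.coe_coe,
    evalRingHom_apply, MvPolynomial.coe_eval₂Hom] at this
  rw [MvPolynomial.eval_map]
  exact this

variable {σ : Type*}

/-- Every regular function on `U` is a polynomial in the generators of a presentation of the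
`k`-algebra `Γ(X, U)`, as a function on `U(L)`: `s(Q) = (σ s)^L(x(Q))`.
[Serre, GAGA §2 n°5; Mumford, *Red Book* I §10] [folklore] -/
theorem _root_.Literature.AlgebraicGeometry.Motives.AlgPoints.eval_eq_eval_map_σ (P : Algebra.Generators k Γ(X.left, U) ι) {Q : AlgPoints X L}
    (h : Q.pt ∈ U) (s : Γ(X.left, U)) :
    Q.eval U h s = MvPolynomial.eval (fun i ↦ evalOrZero U (P.val i) Q)
      (MvPolynomial.map (algebraMap k L) (P.σ s)) := by
  rw [← eval_aeval_eq_eval_map halg P.val h, P.aeval_val_σ]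

/-- The coordinates of a point of `U(L)` satisfy the relations of a presentation of `Γ(X, U)`:
`x(Q)` lies on the zero set `{F = 0} ⊆ L^ι` of the relations read over `L`.
[Serre, GAGA §2 n°5, Lemme 1 b)] [folklore] -/
theorem _root_.Literature.AlgebraicGeometry.Motives.AlgPoints.eval_map_relation_eq_zero (P : Algebra.Presentation k Γ(X.left, U) ι σ) {Q : AlgPoints X L}
    (h : Q.pt ∈ U) (j : σ) :
    MvPolynomial.eval (fun i ↦ evalOrZero U (P.val i) Q)
      (MvPolynomial.map (algebraMap k L) (P.relation j)) = 0 := by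
  rw [← eval_aeval_eq_eval_map halg P.val h, P.aeval_val_relation, ← evalRingHom_apply, map_zero]

/-- On an affine open, the coordinates attached to generators of `Γ(X, U)` separate the points
of `U(L)`. [Mumford, *Red Book* I §10] [folklore] -/
theorem _root_.Literature.AlgebraicGeometry.Motives.AlgPoints.eq_of_evalOrZero_val_eq (hU : IsAffineOpen U) (P : Algebra.Generators k Γ(X.left, U) ι)
    {Q Q' : AlgPoints X L} (hQ : Q.pt ∈ U) (hQ' : Q'.pt ∈ U)
    (e : (fun i ↦ evalOrZero U (P.val i) Q) = fun i ↦ evalOrZero U (P.val i) Q') : Q = Q' :=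
  ext_of_forall_eval_eq hU hQ hQ' fun s ↦ by
    rw [eval_eq_eval_map_σ halg P hQ, eval_eq_eval_map_σ halg P hQ', e]

/-- **Points of an affine open are the points of the zero set of a presentation.** For `U`
affine with presentation `Γ(X, U) = k[xᵢ]/(F_j)`, every `z ∈ L^ι` with `F_j^L(z) = 0` for all `j`
is the coordinate vector of a point of `U(L)` (the `k`-algebra map `k[xᵢ] → L`, `xᵢ ↦ zᵢ`
factors through `Γ(X, U)`, and `k`-algebra maps `Γ(X, U) → L` are points of `U(L)`,
`AlgPoints.ofRingHom` of `AlgPointsProperProofs`).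
[Serre, GAGA §2 n°5; Mumford, *Red Book* II §4 & I §10] [folklore] -/
theorem _root_.Literature.AlgebraicGeometry.Motives.AlgPoints.exists_evalOrZero_val_eq (hU : IsAffineOpen U)
    (P : Algebra.Presentation k Γ(X.left, U) ι σ) (z : ι → L)
    (hz : ∀ j, MvPolynomial.eval z (MvPolynomial.map (algebraMap k L) (P.relation j)) = 0) :
    ∃ Q : AlgPoints X L, Q.pt ∈ U ∧ (fun i ↦ evalOrZero U (P.val i) Q) = z := by
  let evz : P.Ring →+* L := MvPolynomial.eval₂Hom (algebraMap k L) z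
  have hker : RingHom.ker (algebraMap P.Ring Γ(X.left, U)) ≤ RingHom.ker evz := by
    change P.ker ≤ _
    rw [← P.span_range_relation_eq_ker, Ideal.span_le]
    rintro _ ⟨j, rfl⟩
    simp only [SetLike.mem_coe, RingHom.mem_ker]
    rw [← hz j, MvPolynomial.eval_map]
    rfl
  let φ : Γ(X.left, U) →+* L :=
    (algebraMap P.Ring Γ(X.left, U)).liftOfSurjective P.algebraMap_surjective ⟨evz, hker⟩
  have hφ : ∀ p : P.Ring, φ (algebraMap P.Ring Γ(X.left, U) p) = evz p :=
    (algebraMap P.Ring Γ(X.left, U)).liftOfSurjective_comp_apply P.algebraMap_surjective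
      ⟨evz, hker⟩
  have hφc : ∀ c : k, φ (Literature.AlgebraicGeometry.Motives.SchemeOver.scalarRingHom X U c) = algebraMap k L c := fun c ↦ by
    rw [← halg, show algebraMap k Γ(X.left, U) c = algebraMap P.Ring Γ(X.left, U) (C c) by
      rw [P.algebraMap_apply, MvPolynomial.algHom_C], hφ]
    simp [evz]
  have hφ' : φ.comp (Literature.AlgebraicGeometry.Motives.SchemeOver.scalarRingHom X U) = algebraMap k L := RingHom.ext hφc
  refine ⟨ofRingHom hU φ hφ', pt_ofRingHom_mem hU φ hφ', funext fun i ↦ ?_⟩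
  rw [evalOrZero_of_mem _ (pt_ofRingHom_mem hU φ hφ'), eval_ofRingHom]
  rw [show P.val i = algebraMap P.Ring Γ(X.left, U) (MvPolynomial.X i) by
    rw [P.algebraMap_apply, MvPolynomial.aeval_X], hφ]
  simp [evz]

omit [Algebra k ↑Γ(↑X.left, U)] halg in
/-- **The strong topology on an affine open is the topology of pointwise convergence of the
values of the regular functions** [Serre, GAGA §2 n°5, Remarque 1: «la moins fine rendant
continues les fonctions régulières»; Lemme 1 a)]: for `U ⊆ X` affine and `L` a `T₁` topological
field, `U(L) → L^{Γ(X, U)}`, `Q ↦ (a ↦ a(Q))` is inducing. This is the subspace form of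
`AlgPoints.nhds_eq_of_mem_affineOpen` (`AlgPointsProperProofs`: near a point of `U(L)` the
neighbourhood filter is `𝓟 U(L) ⊓ ⨅ₐ comap a (𝓝 a(P))`).
[cite: SerreGAGA1956, §2 n°5 Lemme 1] [cite: ConradAdelicPoints2012, Prop. 2.1 (p. 2)] -/
theorem _root_.Literature.AlgebraicGeometry.Motives.AlgPoints.isInducing_pi_eval [TopologicalSpace L] [IsTopologicalDivisionRing L] [T1Space L]
    (hU : IsAffineOpen U) :
    IsInducing fun (Q : {Q : AlgPoints X L // Q.pt ∈ U}) (a : Γ(X.left, U)) ↦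
      Q.1.eval U Q.2 a := by
  refine isInducing_iff_nhds.mpr fun Q ↦ le_antisymm ?_ ?_
  · refine (Continuous.tendsto ?_ Q).le_comap
    refine continuous_pi fun a ↦ ?_
    have : (fun Q : {Q : AlgPoints X L // Q.pt ∈ U} ↦ Q.1.eval U Q.2 a) =
        {Q : AlgPoints X L | Q.pt ∈ U}.restrict (evalOrZero U a) := by
      funext Q
      exact (evalOrZero_of_mem a Q.2).symm
    rw [this]
    exact continuousOn_iff_continuous_restrict.mp (continuousOn_evalOrZero U a)
  · rw [nhds_subtype, nhds_eq_of_mem_affineOpen hU Q.2, Filter.comap_inf, Filter.comap_principal]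
    refine le_inf (Filter.le_principal_iff.mpr (Filter.univ_mem' fun Q' ↦ Q'.2)) ?_
    rw [Filter.comap_iInf]
    refine le_iInf fun a ↦ ?_
    rw [Filter.comap_comap]
    have h1 : evalOrZero U a ∘ (Subtype.val : {Q : AlgPoints X L // Q.pt ∈ U} → AlgPoints X L) =
        (fun f : Γ(X.left, U) → L ↦ f a) ∘
          fun (Q : {Q : AlgPoints X L // Q.pt ∈ U}) (a : Γ(X.left, U)) ↦ Q.1.eval U Q.2 a := by
      funext Q'
      exact evalOrZero_of_mem a Q'.2
    have h2 : Filter.comap (fun (Q' : {Q : AlgPoints X L // Q.pt ∈ U}) (a : Γ(X.left, U)) ↦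
        Q'.1.eval U Q'.2 a) (Filter.comap (fun f : Γ(X.left, U) → L ↦ f a)
          (𝓝 (Q.1.eval U Q.2 a))) =
        Filter.comap (evalOrZero U a ∘ Subtype.val) (𝓝 (evalOrZero U a Q.1)) := by
      rw [Filter.comap_comap, ← h1, evalOrZero_of_mem a Q.2]
    exact le_of_le_of_eq (Filter.comap_mono ((continuous_apply a).tendsto _).le_comap) h2

omit [Algebra k ↑Γ(↑X.left, U)] halg in
/-- **Local fractions.** On an affine open `U`, a section `s` over an open `W` is, near a point
`x ∈ U ∩ W`, a fraction with numerator and denominator in `Γ(X, U)`: there are `f, g ∈ Γ(X, U)`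
and `n` with `x ∈ D(f) ⊆ W` and `s|_{D(f)} · fⁿ = g|_{D(f)}` (`Γ(X, D(f)) = Γ(X, U)_f`, Mathlib
`IsAffineOpen.isLocalization_basicOpen`), so that `s(Q) f(Q)ⁿ = g(Q)` for every `Q ∈ D(f)(L)`.
(A packaging of Mathlib `IsAffineOpen.exists_basicOpen_le` with
`AlgPoints.exists_map_mul_pow_eq_algebraMap` / `eval_eq_div_of_map_mul_pow_eq` of
`AlgPointsProperProofs`, in the form used for the holomorphy of regular functions below.)
[Hartshorne II Prop. 2.2 (b); Serre, GAGA §2 n°5, proof of Lemme 1 c)] [folklore] -/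
theorem _root_.Literature.AlgebraicGeometry.Motives.AlgPoints.exists_fraction (hU : IsAffineOpen U) {W : X.left.Opens}
    (s : Γ(X.left, W)) {x : X.left} (hxU : x ∈ U) (hxW : x ∈ W) :
    ∃ (f g : Γ(X.left, U)) (n : ℕ) (hle : X.left.basicOpen f ≤ W), x ∈ X.left.basicOpen f ∧
      ∀ (Q : AlgPoints X L) (hQ : Q.pt ∈ X.left.basicOpen f),
        Q.eval W (hle hQ) s * Q.eval U (X.left.basicOpen_le f hQ) f ^ n =
          Q.eval U (X.left.basicOpen_le f hQ) g := by
  obtain ⟨f, hfW, hxf⟩ := hU.exists_basicOpen_le ⟨x, hxW⟩ hxU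
  haveI := hU.isLocalization_basicOpen f
  obtain ⟨n, g, hg⟩ := IsLocalization.Away.surj f (X.left.presheaf.map (homOfLE hfW).op s)
  refine ⟨f, g, n, hfW, hxf, fun Q hQ ↦ ?_⟩
  have H := congrArg (evalRingHom Q (X.left.basicOpen f) hQ) hg
  simp only [map_mul, map_pow, evalRingHom_apply, RingHom.algebraMap_toAlgebra] at H
  rwa [eval_map_homOfLE, eval_map_homOfLE, eval_map_homOfLE] at H

/-- **The strong topology on `U(L)` is induced by finitely many coordinates**: for `U` affine and
generators `xᵢ` of the `k`-algebra `Γ(X, U)`, the map `U(L) → L^ι`, `Q ↦ (xᵢ(Q))ᵢ` is inducing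
(every regular function on `U` is a polynomial in the `xᵢ`, and `U(L) → L^{Γ(X, U)}` is
inducing, `isInducing_pi_eval`). This is Serre's description of the topology of `X^h` on an
affine piece as that of a Zariski-locally closed subset of `ℂⁿ`.
[Serre, GAGA §2 n°5, Lemme 1 a) and Remarque] [folklore] -/
theorem _root_.Literature.AlgebraicGeometry.Motives.AlgPoints.isInducing_evalOrZero_val [TopologicalSpace L] [IsTopologicalDivisionRing L] [T1Space L]
    (hU : IsAffineOpen U) (P : Algebra.Generators k Γ(X.left, U) ι) :
    IsInducing fun (Q : {Q : AlgPoints X L // Q.pt ∈ U}) i ↦ evalOrZero U (P.val i) Q.1 := by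
  let Φ : (ι → L) → (Γ(X.left, U) → L) := fun z s ↦
    MvPolynomial.eval z (MvPolynomial.map (algebraMap k L) (P.σ s))
  have hΦ : Continuous Φ := continuous_pi fun s ↦ MvPolynomial.continuous_eval _
  have hx : Continuous fun (Q : {Q : AlgPoints X L // Q.pt ∈ U}) i ↦
      evalOrZero U (P.val i) Q.1 :=
    continuousOn_iff_continuous_restrict.mp (continuousOn_evalOrZero_pi P.val)
  refine IsInducing.of_comp hx hΦ ?_
  convert isInducing_pi_eval (L := L) hU using 1
  funext Q s
  exact (eval_eq_eval_map_σ halg P Q.2 s).symm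

/-- **The Jacobian at a point.** The value at `Q ∈ U(L)` of the Jacobian of a pre-submersive
presentation of the `k`-algebra `Γ(X, U)` is the Jacobian minor `det ((∂F_j/∂x_{map i})(x(Q)))`
of the relations read over `L`, taken at the coordinates of `Q`.
[Bosch, *Algebraic Geometry and Commutative Algebra* §8.5; Serre, GAGA §1 n°4] [folklore] -/
theorem _root_.Literature.AlgebraicGeometry.Motives.AlgPoints.eval_jacobian [Fintype σ] [DecidableEq σ]
    (P : Algebra.PreSubmersivePresentation k Γ(X.left, U) ι σ) {Q : AlgPoints X L}
    (h : Q.pt ∈ U) :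
    Q.eval U h P.jacobian =
      (Matrix.of fun i j : σ ↦ MvPolynomial.eval (fun i ↦ evalOrZero U (P.val i) Q)
        (pderiv (P.map i) (MvPolynomial.map (algebraMap k L) (P.relation j)))).det := by
  rw [P.jacobian_eq_jacobiMatrix_det, RingHom.map_det, ← evalRingHom_apply, RingHom.map_det]
  congr 1
  ext i j
  simp only [RingHom.mapMatrix_apply, Matrix.map_apply, Matrix.of_apply, evalRingHom_apply,
    P.jacobiMatrix_apply, Algebra.Generators.algebraMap_apply, MvPolynomial.pderiv_map]
  exact eval_aeval_eq_eval_map halg P.val h _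

/-- For a submersive presentation of `Γ(X, U)` the Jacobian minor is non-zero at every point of
`U(L)` (the Jacobian is a unit of `Γ(X, U)`, and evaluation at a point is a ring homomorphism
to a field). [Bosch §8.5 Prop. 2; Serre, GAGA §1 n°4] [folklore] -/
theorem _root_.Literature.AlgebraicGeometry.Motives.AlgPoints.det_ne_zero_of_submersivePresentation [Fintype σ] [DecidableEq σ]
    (P : Algebra.SubmersivePresentation k Γ(X.left, U) ι σ) {Q : AlgPoints X L}
    (h : Q.pt ∈ U) :
    (Matrix.of fun i j : σ ↦ MvPolynomial.eval (fun i ↦ evalOrZero U (P.val i) Q)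
      (pderiv (P.map i) (MvPolynomial.map (algebraMap k L) (P.relation j)))).det ≠ 0 := by
  rw [← eval_jacobian halg P.toPreSubmersivePresentation h, ← evalRingHom_apply]
  exact (P.jacobian_isUnit.map _).ne_zero

end Generators

end AlgPoints

/-- Splitting the variables of a presentation of dimension `d` into `d` free variables and the
variables `map j` singled out by the relations: an equivalence `Fin d ⊕ σ ≃ ι` extending the
injection `map : σ → ι`, when `#ι - #σ = d`. [folklore] -/
theorem exists_equiv_sum_of_card_eq {ι σ : Type*} [Fintype ι] [Fintype σ] (m : σ → ι)
    (hm : Function.Injective m) {d : ℕ} (hd : Fintype.card ι - Fintype.card σ = d) :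
    ∃ E : Fin d ⊕ σ ≃ ι, ∀ j, E (Sum.inr j) = m j := by
  classical
  have hc : Fintype.card ((Set.range m)ᶜ : Set ι) = d := by
    rw [Fintype.card_compl_set, Set.card_range_of_injective hm, hd]
  let eτ : ((Set.range m)ᶜ : Set ι) ≃ Fin d := Fintype.equivFinOfCardEq hc
  refine ⟨(Equiv.sumCongr eτ.symm (Equiv.ofInjective m hm)).trans
    ((Equiv.sumComm _ _).trans (Equiv.Set.sumCompl (Set.range m))), fun j ↦ ?_⟩
  simp [Equiv.Set.sumCompl_apply_inl]

/-! ### Holomorphic algebraic charts -/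

/-- **Holomorphic algebraic charts exist (discharge of `Literature.NumberTheory.Transcendental.exists_algebraicChart`).** Every
complex point `P₀` of a `k`-scheme `X` (`k ⊆ ℂ`), locally of finite type and smooth of relative
dimension `d`, lies in the source of a chart `e` of `X(ℂ)` (strong topology) onto an open subset
of `ℂᵈ` whose coordinates are regular functions `x_{E t} ∈ Γ(X, V)` on an affine open `V`
(`d` of the generators of a submersive presentation of `Γ(X, V)`, the chart being inverted by the
holomorphic implicit function theorem `Literature.NumberTheory.Transcendental.exists_implicitChart`), and in which every regular
function on every affine open `U'` is `C^ω` (locally a quotient `G(ψ w)/F(ψ w)ᵐ` of polynomials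
in the holomorphic inverse `ψ`). See the module docstring for the four steps.
[Serre, GAGA §2 n°5 Lemme 1, Prop. 2 and n°6 Prop. 3, Cor. 2; SGA1 XII Thm. 1.1, Prop. 3.1 (iv)]
[cite: SerreGAGA1956, §2 n°5 Prop. 2 and n°6 Prop. 3 Cor. 2] -/
theorem exists_algebraicChart_holds {k : Type} [Field k] [Algebra k ℂ] (X : Literature.AlgebraicGeometry.Motives.SchemeOver k)
    (d : ℕ) : exists_algebraicChart X d := by
  intro _ _ P₀
  classical
  -- Step 1: a standard smooth affine neighbourhood `V` of `P₀` and a submersive presentation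
  obtain ⟨V, hV, hP₀V, hsm⟩ :=
    Literature.AlgebraicGeometry.Motives.AlgPoints.exists_isStandardSmoothOfRelativeDimension_scalarRingHom d P₀
  letI : Algebra k Γ(X.left, V) := (Literature.AlgebraicGeometry.Motives.SchemeOver.scalarRingHom X V).toAlgebra
  have halg : ∀ c, algebraMap k Γ(X.left, V) c = Literature.AlgebraicGeometry.Motives.SchemeOver.scalarRingHom X V c := fun c ↦ rfl
  obtain ⟨ι, σ, _, _, P, hPd⟩ := hsm.out
  letI := Fintype.ofFinite ι
  letI := Fintype.ofFinite σ
  -- Step 2: coordinates and equations over `ℂ`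
  set x : Literature.AlgebraicGeometry.Motives.ComplexPoints X → ι → ℂ := fun Q i ↦ Literature.AlgebraicGeometry.Motives.AlgPoints.evalOrZero V (P.val i) Q with hx
  let F : σ → MvPolynomial ι ℂ := fun j ↦ MvPolynomial.map (algebraMap k ℂ) (P.relation j)
  have hPd' : Fintype.card ι - Fintype.card σ = d := by
    simpa [Algebra.Presentation.dimension, Nat.card_eq_fintype_card] using hPd
  obtain ⟨E, hE⟩ := exists_equiv_sum_of_card_eq P.map P.map_inj hPd'
  have hJ : (Matrix.of fun i j : σ ↦ eval (x P₀) (pderiv (E (Sum.inr i)) (F j))).det ≠ 0 := by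
    simp_rw [hE]
    exact Literature.AlgebraicGeometry.Motives.AlgPoints.det_ne_zero_of_submersivePresentation halg P hP₀V
  -- Step 3: the implicit function theorem
  obtain ⟨Ω, T, ψ, hΩ, hz₀Ω, hT, hψ, hΩZ, hTZ⟩ := exists_implicitChart E F (x P₀) hJ
  have hZ : ∀ Q : Literature.AlgebraicGeometry.Motives.ComplexPoints X, Q.pt ∈ V → ∀ j, eval (x Q) (F j) = 0 :=
    fun Q hQ j ↦ Literature.AlgebraicGeometry.Motives.AlgPoints.eval_map_relation_eq_zero halg P.toPresentation hQ j
  have hsurj : ∀ z, (∀ j, eval z (F j) = 0) → ∃ Q : Literature.AlgebraicGeometry.Motives.ComplexPoints X, Q.pt ∈ V ∧ x Q = z :=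
    fun z hz ↦ Literature.AlgebraicGeometry.Motives.AlgPoints.exists_evalOrZero_val_eq halg hV P.toPresentation z hz
  have hinj : ∀ Q Q' : Literature.AlgebraicGeometry.Motives.ComplexPoints X, Q.pt ∈ V → Q'.pt ∈ V → x Q = x Q' → Q = Q' :=
    fun Q Q' hQ hQ' e ↦ Literature.AlgebraicGeometry.Motives.AlgPoints.eq_of_evalOrZero_val_eq halg hV P.toGenerators hQ hQ' e
  have hind : IsInducing fun Q : {Q : Literature.AlgebraicGeometry.Motives.ComplexPoints X // Q.pt ∈ V} ↦ x Q.1 :=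
    Literature.AlgebraicGeometry.Motives.AlgPoints.isInducing_evalOrZero_val halg hV P.toGenerators
  have hxc : ContinuousOn x {Q | Q.pt ∈ V} := Literature.AlgebraicGeometry.Motives.AlgPoints.continuousOn_evalOrZero_pi P.val
  -- Step 4: the chart
  let inv : (Fin d → ℂ) → Literature.AlgebraicGeometry.Motives.ComplexPoints X := fun w ↦
    if h : ∃ Q : Literature.AlgebraicGeometry.Motives.ComplexPoints X, Q.pt ∈ V ∧ x Q = ψ w then h.choose else P₀
  have hinv : ∀ w ∈ T, (inv w).pt ∈ V ∧ x (inv w) = ψ w := fun w hw ↦ by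
    have h : ∃ Q : Literature.AlgebraicGeometry.Motives.ComplexPoints X, Q.pt ∈ V ∧ x Q = ψ w := hsurj (ψ w) (hTZ w hw).2.1
    simp only [inv, dif_pos h]
    exact h.choose_spec
  let π : (ι → ℂ) → (Fin d → ℂ) := fun z t ↦ z (E (Sum.inl t))
  have hπ : Continuous π := continuous_pi fun t ↦ continuous_apply _
  let e : OpenPartialHomeomorph (Literature.AlgebraicGeometry.Motives.ComplexPoints X) (Fin d → ℂ) :=
  { toFun := fun Q ↦ π (x Q)
    invFun := inv
    source := {Q | Q.pt ∈ V} ∩ x ⁻¹' Ω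
    target := T
    map_source' := fun Q hQ ↦ (hΩZ (x Q) hQ.2 (hZ Q hQ.1)).1
    map_target' := fun w hw ↦ ⟨(hinv w hw).1, by
      change x (inv w) ∈ Ω
      rw [(hinv w hw).2]
      exact (hTZ w hw).1⟩
    left_inv' := fun Q hQ ↦ by
      have h1 := hΩZ (x Q) hQ.2 (hZ Q hQ.1)
      have h2 := hinv (π (x Q)) h1.1
      exact hinj _ _ h2.1 hQ.1 (h2.2.trans h1.2)
    right_inv' := fun w hw ↦ by
      rw [(hinv w hw).2]
      exact (hTZ w hw).2.2
    open_source := hxc.isOpen_inter_preimage (Literature.AlgebraicGeometry.Motives.AlgPoints.isOpen_setOf_pt_mem V) hΩ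
    open_target := hT
    continuousOn_toFun := (hπ.comp_continuousOn hxc).mono Set.inter_subset_left
    continuousOn_invFun := by
      rw [continuousOn_iff_continuous_restrict]
      have h1 : Continuous fun w : T ↦
          (⟨inv w, (hinv w w.2).1⟩ : {Q : Literature.AlgebraicGeometry.Motives.ComplexPoints X // Q.pt ∈ V}) := by
        rw [hind.continuous_iff]
        have : ((fun Q : {Q : Literature.AlgebraicGeometry.Motives.ComplexPoints X // Q.pt ∈ V} ↦ x Q.1) ∘ fun w : T ↦
            (⟨inv w, (hinv w w.2).1⟩ : {Q : Literature.AlgebraicGeometry.Motives.ComplexPoints X // Q.pt ∈ V})) = T.restrict ψ := by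
          funext w
          exact (hinv w w.2).2
        rw [this]
        exact continuousOn_iff_continuous_restrict.mp hψ.continuousOn
      exact continuous_subtype_val.comp h1 }
  have he_symm : ∀ w, e.symm w = inv w := fun w ↦ rfl
  refine ⟨e, ⟨hP₀V, hz₀Ω⟩, ⟨⟨V, hV⟩, fun t ↦ P.val (E (Sum.inl t)), fun Q hQ ↦ hQ.1,
    fun Q _ t ↦ rfl⟩, ?_⟩
  -- Step 5: regular functions are holomorphic in the chart
  intro U' s
  suffices H : AnalyticOnNhd ℂ (Literature.AlgebraicGeometry.Motives.AlgPoints.evalOrZero ↑U' s ∘ e.symm)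
      (e.target ∩ e.symm ⁻¹' {Q | Q.pt ∈ (U' : X.left.Opens)}) from
    H.contDiffOn_of_completeSpace
  rintro w₁ ⟨hw₁T, hw₁U'⟩
  have hQ₁ := hinv w₁ hw₁T
  obtain ⟨f, g, n, hle, hQ₁f, Hfrac⟩ :=
    Literature.AlgebraicGeometry.Motives.AlgPoints.exists_fraction (L := ℂ) hV s hQ₁.1 hw₁U'
  let fC : MvPolynomial ι ℂ := MvPolynomial.map (algebraMap k ℂ) (P.σ f)
  let gC : MvPolynomial ι ℂ := MvPolynomial.map (algebraMap k ℂ) (P.σ g)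
  have hfC : ∀ (Q : Literature.AlgebraicGeometry.Motives.ComplexPoints X) (hQ : Q.pt ∈ V), Q.eval V hQ f = eval (x Q) fC :=
    fun Q hQ ↦ Literature.AlgebraicGeometry.Motives.AlgPoints.eval_eq_eval_map_σ halg P.toGenerators hQ f
  have hgC : ∀ (Q : Literature.AlgebraicGeometry.Motives.ComplexPoints X) (hQ : Q.pt ∈ V), Q.eval V hQ g = eval (x Q) gC :=
    fun Q hQ ↦ Literature.AlgebraicGeometry.Motives.AlgPoints.eval_eq_eval_map_σ halg P.toGenerators hQ g
  -- the neighbourhood `{w ∈ T | f(ψ w) ≠ 0}` of `w₁`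
  let N₁ : Set (Fin d → ℂ) := T ∩ (fun w ↦ eval (ψ w) fC) ⁻¹' {a | a ≠ 0}
  have hN₁ : IsOpen N₁ :=
    ((MvPolynomial.continuous_eval fC).comp_continuousOn hψ.continuousOn).isOpen_inter_preimage
      hT isOpen_ne
  have hf₁ : eval (ψ w₁) fC ≠ 0 := by
    rw [← hQ₁.2, ← hfC _ hQ₁.1]
    exact (Literature.AlgebraicGeometry.Motives.AlgPoints.eval_ne_zero_iff_mem_basicOpen _ V hQ₁.1 f).mpr hQ₁f
  have hw₁N₁ : w₁ ∈ N₁ := ⟨hw₁T, hf₁⟩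
  have hanalytic : AnalyticAt ℂ (fun w ↦ eval (ψ w) gC / eval (ψ w) fC ^ n) w₁ := by
    have hψ₁ : AnalyticAt ℂ ψ w₁ := hψ w₁ hw₁T
    refine (((AnalyticOnNhd.eval_mvPolynomial gC) _ (Set.mem_univ _)).comp hψ₁).div
      ((((AnalyticOnNhd.eval_mvPolynomial fC) _ (Set.mem_univ _)).comp hψ₁).pow n) ?_
    exact pow_ne_zero n hf₁
  refine hanalytic.congr ?_
  filter_upwards [hN₁.mem_nhds hw₁N₁] with w hw
  obtain ⟨hwT, hwf⟩ := hw
  obtain ⟨hQV, hxQ⟩ := hinv w hwT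
  have hwf' : eval (x (inv w)) fC ≠ 0 := by
    rw [hxQ]
    exact hwf
  have hQf : (inv w).pt ∈ X.left.basicOpen f := by
    refine (Literature.AlgebraicGeometry.Motives.AlgPoints.eval_ne_zero_iff_mem_basicOpen _ V hQV f).mp ?_
    rw [hfC _ hQV]
    exact hwf'
  have H := Hfrac (inv w) hQf
  rw [hfC _ hQV, hgC _ hQV, hxQ] at H
  rw [Function.comp_apply, he_symm, Literature.AlgebraicGeometry.Motives.AlgPoints.evalOrZero_of_mem s (hle hQf), ← H,
    mul_div_assoc, div_self (pow_ne_zero n hwf), mul_one]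

end Literature.NumberTheory.Transcendental
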